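import Mathlib
import Summits.ValiantsHypothesis.ValiantsHypothesis.Theses.RefutationDegree
import Summits.ValiantsHypothesis.ValiantsHypothesis.Theses.GCTMult
import Literature.Computability.Complexity.HermitianSosRefutation
import Literature.Computability.AlgebraicComplexity.OrbitClosure

/-!
# Sketch — crux idea `skoda-border-sandwich` for crux `CertWindowQP` (stmt-ValiantsHypothesis-5640)

Lever: the Łojasiewicz exponent at infinity `ℒ(n,m)` of the fibre system
`g_μ(a) = coeff_μ det(A₀ + Σ x_e A_e) − coeff_μ per_n` sandwiches the refutation degree:

  `ℒ + m ≤ D_SOS(n,m) ≤ D_NS(n,m) ≤ (N+1)(ℒ + m) + 1`,  `N = (n²+1)m²`,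

(lower half: Cauchy–Schwarz on the Hermitian identity at `(a, ā)`; upper half: Skoda's `L²`
division theorem with weight `(1+|a|²)^{-K}`, the analytic step of Brownawell 1987), and
`ℒ(n,m) = 0` as soon as `per_n` is not in the (Euclidean = Zariski) closure of the size-`m` affine
determinantal expressions, which follows from `X₀₀^{m-n} per_n ∉ Δ[det_m]`.
Hence `GCTMult.GctThesis → CertWindowQP` with `c' = 5`.

Everything below elaborates; proofs are deliberately `sorry` (crux-ideate stage: no skeleton).
-/

noncomputable section

open scoped BigOperators
open MvPolynomial

namespace Summit.ValiantsHypothesis.ValiantsHypothesis.Cruxes.CertWindowQP.SkodaBorderSandwich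

open Literature.Computability.AlgebraicComplexity Literature.Computability.Complexity

/-- Unknowns of `Rep(n,m)`: entries of `A₀` (tag `none`) and of the `A_e` (tag `some e`);
`N = (n²+1)m²` of them. -/
abbrev RepVar (n m : ℕ) : Type := Option (Fin n × Fin n) × (Fin m × Fin m)

/-- The defect `P(n,m) = det(A₀ + Σ_e x_e A_e) − per_n ∈ (ℂ[unknowns])[x]` — verbatim the route's
`let P`. -/
def repDefect (n m : ℕ) : MvPolynomial (Fin n × Fin n) (MvPolynomial (RepVar n m) ℂ) :=
  (Matrix.of fun i j : Fin m =>
      MvPolynomial.C (MvPolynomial.X (none, (i, j))) +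
        ∑ e : Fin n × Fin n, MvPolynomial.X e * MvPolynomial.C (MvPolynomial.X (some e, (i, j))) :
      Matrix (Fin m) (Fin m) (MvPolynomial (Fin n × Fin n) (MvPolynomial (RepVar n m) ℂ))).det -
    MvPolynomial.map MvPolynomial.C (perPoly (Fin n) ℂ)

/-- The system `Rep(n,m)`: one axiom `eqn_μ = coeff_μ P` per `x`-exponent `μ` (zero off the
support). -/
def repSystem (n m : ℕ) : ((Fin n × Fin n) →₀ ℕ) → MvPolynomial (RepVar n m) ℂ :=
  fun μ => (repDefect n m).coeff μ

/-- `D_NS(n,m) ≤ d`, in the Literature vocabulary (Krajíček §6.2). -/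
def HasNs (n m d : ℕ) : Prop := HasNSRefutationOfDegree (repSystem n m) d

/-- `D_SOS(n,m) ≤ d` (Hermitian Positivstellensatz refutation, the crux's notion). -/
def HasSos (n m d : ℕ) : Prop := HasHermitianSosRefutationOfDegree (repSystem n m) d

/-- `‖Φ_m(a) − per_n‖²`: squared coefficient distance between `det(A₀ + Σ x_e A_e)` at the point `a`
of unknown-space and `per_n`. -/
def defectNormSq (n m : ℕ) (a : RepVar n m → ℂ) : ℝ :=
  ∑ μ ∈ (repDefect n m).support, ‖MvPolynomial.eval a (repSystem n m μ)‖ ^ 2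

/-- **Łojasiewicz inequality at infinity with exponent `E`** for `Rep(n,m)`:
`‖Φ_m(a) − per_n‖² ≥ ε · (1 + ‖a‖²)^{−E}` for all `a`. The least such `E` is `ℒ(n,m)`;
`E = 0` says `per_n` has positive distance from ALL size-`m` affine determinantal expressions. -/
def LojAtInfinity (n m : ℕ) (E : ℝ) : Prop :=
  ∃ ε : ℝ, 0 < ε ∧ ∀ a : RepVar n m → ℂ,
    ε * (1 + ∑ v, ‖a v‖ ^ 2) ^ (-E) ≤ defectNormSq n m a

/-! ### First lemma (easy half of the sandwich; provable now, size M) -/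

/-- **First lemma.** A Hermitian-SOS refutation with all products of degree `≤ d` forces the
Łojasiewicz exponent at infinity to be `≤ d − m` (for `n ≤ m` every axiom in the support has
total degree exactly `m`, so `deg h_μ ≤ d − m`; evaluate the identity at `(a, ā)`:
`1 ≤ 1 + Σ|q_j|² = −2 Re Σ h_μ g_μ ≤ 2‖h(a,ā)‖·‖g(a)‖` and `‖h(a,ā)‖ ≤ C (1+‖a‖²)^{(d−m)/2}`).
In particular `D_SOS(n,m) ≥ ℒ(n,m) + m`. -/
theorem lojAtInfinity_of_hasSos {n m d : ℕ} (hnm : n ≤ m) (h : HasSos n m d) :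
    LojAtInfinity n m ((d : ℝ) - m) := by
  sorry

/-! ### The transfer fact (Skoda 1972 / Brownawell 1987 — a TRUE theorem, to be vendored as a
Literature named fact; Lean-XL because of the `L²` theory) -/

/-- **Skoda–Brownawell transfer.** If `Rep(n,m)` (`n ≤ m`, so all axioms have degree `m` in the
`N = (n²+1)m²` unknowns) satisfies a Łojasiewicz inequality at infinity with exponent `E`, then it
has a Nullstellensatz refutation with every product of degree `≤ (N+1)(E+m) + 1`; stated with
slack `2(N+1)(E+m+1)`. (Skoda's division theorem on `ℂ^N` with `f = 1`, weight
`φ = K log(1+|a|²)`, `K = E(αq+1) + N + η`, `q = min(N, #axioms)`, gives holomorphic multipliers of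
polynomial `L²` growth, hence polynomials of degree `< E(αq+1) + αqm + η`.) -/
def SkodaBrownawellTransfer : Prop :=
  ∀ n m E : ℕ, n ≤ m → LojAtInfinity n m (E : ℝ) →
    HasNs n m (2 * ((n ^ 2 + 1) * m ^ 2 + 1) * (E + m + 1))

/-! ### Border non-membership gives exponent zero (provable now, size M) -/

/-- If the padded permanent `X₀₀^{m−n} per_n` is NOT in `Δ[det_m]` then `per_n` has positive
coefficient distance from every size-`m` affine determinantal expression, i.e. exponent `0`:
a sequence `det(A^{(k)}(x)) → per_n` would give `det(ℓ A₀^{(k)} + Σ x_e A_e^{(k)}) ∈ End·det_m`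
(`endOrbit_subset_orbitClosure`) converging coefficientwise to `ℓ^{m−n} per_n`, and a Zariski
closed set is Euclidean closed. (`n < m` supplies the spare variable `ℓ = X₀₀`.) -/
theorem lojAtInfinity_zero_of_not_mem_orbitClosure {n m : ℕ} [NeZero m] (hnm : n < m)
    (h : paddedPerPoly ℂ n m ∉ orbitClosure (detPoly (Fin m) ℂ)) :
    LojAtInfinity n m 0 := by
  sorry

/-! ### The transfer: `GctThesis ⇒ CertWindowQP` with `c' = 5` -/

/-- **C⁺ ⇒ crux.** Border quasi-polynomial hardness of the permanent (route GCTMult's target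
`GctThesis`, item stmt-ValiantsHypothesis-0323) implies `CertWindowQP`, through the Skoda fact and
the route's own support item `NsToSos`: for `c` take `n := max (n₀ c) 2`; `m < n` has degree-`0`
certificates (`eqn_μ = −1` at a permutation monomial); `m = n` embeds into `m = n+1`
(`A ↦ A ⊕ 1`, same certificate degree); `n < m ≤ 2^((log₂ n + c)^c)` gets exponent `0`, hence an NS
refutation of degree `≤ 2((n²+1)m²+1)(m+1) ≤ (m+2)^5`. -/
theorem certWindowQP_of_gctThesis (hS : SkodaBrownawellTransfer)
    (hNS : Summit.ValiantsHypothesis.ValiantsHypothesis.Theses.RefutationDegree.NsToSos)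
    (hG : Summit.ValiantsHypothesis.ValiantsHypothesis.Theses.GCTMult.GctThesis) :
    Summit.ValiantsHypothesis.ValiantsHypothesis.Theses.RefutationDegree.CertWindowQP := by
  sorry

/-! ### By-products for the rest of the route (statements only) -/

/-- Cruxes 2 and 4 of the route coincide modulo the Skoda fact: an SOS refutation of degree `n^c`
at `m = ⌊n²/2⌋+1` gives exponent `≤ n^c`, hence an NS refutation of degree `poly(n)`. -/
theorem beyondHessianNs_of_beyondHessianSos (hS : SkodaBrownawellTransfer)
    (h : Summit.ValiantsHypothesis.ValiantsHypothesis.Theses.RefutationDegree.BeyondHessianSos) :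
    Summit.ValiantsHypothesis.ValiantsHypothesis.Theses.RefutationDegree.BeyondHessianNs := by
  sorry

/-- The barrier horn pins the BORDER determinantal complexity of `per_n` at the
Landsberg–Manivel–Ressayre value: no degree-`n^8` refutation at `m = ⌊n²/2⌋+1` ⇒ exponent `0` fails
⇒ `per_n` is a limit of size-`(⌊n²/2⌋+1)` affine determinantal expressions ⇒
`X₀₀^{m−n} per_n ∈ Δ[det_m]`. So ANY proof of `\underline{dc}(per_n) ≥ n²/2 + 2` infinitely often
refutes `RefutationBarrier`. -/
theorem hasBorderDetRepr_of_refutationBarrier (hS : SkodaBrownawellTransfer)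
    (hB : Summit.ValiantsHypothesis.ValiantsHypothesis.Theses.RefutationDegree.RefutationBarrier) :
    ∃ n₀ : ℕ, ∀ n ≥ n₀, HasBorderDetRepr ℂ n (n ^ 2 / 2 + 1) := by
  sorry


/-- … hence the route's rank-3 crux `RefutationBarrier` (threshold `m ≥ ⌊n²/2⌋+1`) is refuted by
the Mulmuley–Sohoni conjecture (already at its cubic level `m ≤ n³`), modulo the Skoda fact: the
barrier horn as filed asserts near-tightness of the Landsberg–Manivel–Ressayre bound
`\underline{dc}(per_n) ≥ n²/2`. (Message to the tenure planner: restate the barrier threshold above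
the border complexity, e.g. via the exponent `ℒ`.) -/
theorem not_refutationBarrier_of_mulmuleySohoni (hS : SkodaBrownawellTransfer)
    (hMS : Literature.Computability.AlgebraicComplexity.MulmuleySohoniConjecture) :
    ¬ Summit.ValiantsHypothesis.ValiantsHypothesis.Theses.RefutationDegree.RefutationBarrier := by
  sorry

/-- Monotonicity in `m` (certificates pull back along `A ↦ A ⊕ 1`): used for the `m = n` corner. -/
theorem hasNs_mono_size {n m m' d : ℕ} (hmm' : m ≤ m') (h : HasNs n m' d) : HasNs n m d := by
  sorry

end Summit.ValiantsHypothesis.ValiantsHypothesis.Cruxes.CertWindowQP.SkodaBorderSandwich
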